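import Mathlib
import Literature.Computability.AlgebraicComplexity.NestFreeMatchingFifo
import Summits.ValiantsHypothesis.ValiantsHypothesis.Theorems.FifoMatchingNNMonotoneHardPadBoundaries
import Summits.ValiantsHypothesis.ValiantsHypothesis.Theorems.FifoMatchingNNLinearDegreeCofactorHardShedWordQueue
import HarnessLib

/-!
# Crux `NNLinearDegreeCofactorHard` (stmt-ValiantsHypothesis-23918), line `internal_cofactor`, stub S2b (ii):
# the shed queue word as an ABSTRACT QUEUE HISTORY (instantiation of `…NNMonotoneHardBoundaries` / `…QueueGenealogy`)

The deterministic heart of the μ* design (`Lines/internal_cofactor-S2b-shed-design-p1.md`, (D*)) and the LEAD's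
measure-agnostic genealogy / gate-span lemmas (`…QueueGenealogy`, `…QueueLineage`) live on the abstract queue history of
`…FifoMatchingNNMonotoneHardBoundaries`: letters `W : ℕ → Bool`, ranks `rO rC`, item times `o c`, a respected colouring
`σ`, with the axioms `hO0 hC0 hOs hCs ho hc hresp`.  This file instantiates that interface with `shedWord R H E y`
(template: `…NNMonotoneHardPadBoundaries`):

* `W := shedLetter R H E y`, `rO t := pushes (shedPrefix … t)`, `rC t := pops (shedPrefix … t)` — `rankO_zero`,
  `rankC_zero`, `rankO_succ`, `rankC_succ` are the axioms `hO0 hC0 hOs hCs` (for EVERY `t : ℕ`);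
* `openTime k` / `closeTime hbal k` — the `k`-th opener / closer read off `Finset.orderEmbOfFin`; `openTime_lt_iff`,
  `closeTime_lt_iff` are the axioms `ho hc` (with `n' = #openers`), `colour_openTime_eq` is `hresp` for a set of positions
  respected by the FIFO matching;
* the bridge to the prefix recursion: `openTime_eq_nthTrue` (the `k`-th opener is the position of the `k`-th push) and
  `frontPos_eq_openTime` (the FRONT of `…ShedWordDefs` is item `rC t`);
* the two μ*-specific structural facts the heart uses: `isDefect_frontPos_eq_false_of_push` — **R-items have no
  S-successors** (before the tail, a push at a non-defect position never happens while the front was pushed at a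
  defect: such a position sheds), and `shedLetter_eq_bit_of_front` — every other middle letter is the fair bit.

Honest framing: bookkeeping; nothing here proves (D*), S2b, the crux or VP ≠ VNP (not proved). [folklore]
-/

noncomputable section

-- Sub = Summit single-conjunct layout: the duplicated namespace component is mandated by the tree.
set_option linter.dupNamespace false

namespace Summit.ValiantsHypothesis.ValiantsHypothesis.Theorems.FifoMatching.NNLinearDegreeCofactorHard.ShedWord

open Finset Literature.Computability.AlgebraicComplexity
open Summit.ValiantsHypothesis.ValiantsHypothesis.Theorems.FifoMatching.NNMonotoneHard

variable {N : ℕ} (R : Finset (Fin N)) (H E : ℕ) (y : Fin N → Bool)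

/-! ### Ranks -/

/-- Axiom `hO0`: no pushes before time `0`. [folklore] -/
theorem rankO_zero : pushes (shedPrefix R H E y 0) = 0 := rfl

/-- Axiom `hC0`: no pops before time `0`. [folklore] -/
theorem rankC_zero : pops (shedPrefix R H E y 0) = 0 := rfl

/-- Axiom `hOs`: the push rank steps by the letter. [folklore] -/
theorem rankO_succ (t : ℕ) :
    pushes (shedPrefix R H E y (t + 1)) = pushes (shedPrefix R H E y t) + (if shedLetter R H E y t = true then 1 else 0) := by
  rw [shedPrefix_succ, pushes_append_singleton]

/-- Axiom `hCs`: the pop rank steps by the letter. [folklore] -/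
theorem rankC_succ (t : ℕ) :
    pops (shedPrefix R H E y (t + 1)) = pops (shedPrefix R H E y t) + (if shedLetter R H E y t = true then 0 else 1) := by
  rw [shedPrefix_succ, pops_append_singleton]

/-- Ranks are monotone in time. [folklore] -/
theorem pushes_mono {s t : ℕ} (hst : s ≤ t) : pushes (shedPrefix R H E y s) ≤ pushes (shedPrefix R H E y t) := by
  induction hst with
  | refl => exact le_rfl
  | step _ ih => exact ih.trans (by rw [rankO_succ]; omega)

/-- Ranks are monotone in time. [folklore] -/
theorem pops_mono {s t : ℕ} (hst : s ≤ t) : pops (shedPrefix R H E y s) ≤ pops (shedPrefix R H E y t) := by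
  induction hst with
  | refl => exact le_rfl
  | step _ ih => exact ih.trans (by rw [rankC_succ]; omega)

/-- The total number of pushes is the number of openers. [folklore] -/
theorem pushes_shedPrefix_N : pushes (shedPrefix R H E y N) = (openerSet (shedWord R H E y)).card := by
  rw [pushes_eq_card_openerSet R H E y le_rfl, card_filter_lt_of_le _ le_rfl]

/-- The total number of pops is the number of closers. [folklore] -/
theorem pops_shedPrefix_N : pops (shedPrefix R H E y N) = (closerSet (shedWord R H E y)).card := by
  rw [pops_eq_card_closerSet R H E y le_rfl, card_filter_lt_of_le _ le_rfl]

/-! ### Item times -/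

/-- The time of the `k`-th push (`0`-indexed; junk `0` past the number of openers). [folklore] -/
def openTime (k : ℕ) : ℕ :=
  if hk : k < (openerSet (shedWord R H E y)).card then
    (((openerSet (shedWord R H E y)).orderEmbOfFin rfl ⟨k, hk⟩ : Fin N) : ℕ) else 0

/-- The time of the `k`-th pop of a balanced shed word (junk `0` past the number of openers). [folklore] -/
def closeTime (hbal : (closerSet (shedWord R H E y)).card = (openerSet (shedWord R H E y)).card) (k : ℕ) : ℕ :=
  if hk : k < (openerSet (shedWord R H E y)).card then
    (((closerSet (shedWord R H E y)).orderEmbOfFin hbal ⟨k, hk⟩ : Fin N) : ℕ) else 0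

/-- Item times lie in the window. [folklore] -/
theorem openTime_lt {k : ℕ} (hk : k < (openerSet (shedWord R H E y)).card) : openTime R H E y k < N := by
  unfold openTime; rw [dif_pos hk]; exact Fin.isLt _

/-- Item times lie in the window. [folklore] -/
theorem closeTime_lt (hbal : (closerSet (shedWord R H E y)).card = (openerSet (shedWord R H E y)).card) {k : ℕ}
    (hk : k < (openerSet (shedWord R H E y)).card) : closeTime R H E y hbal k < N := by
  unfold closeTime; rw [dif_pos hk]; exact Fin.isLt _

/-- Axiom `ho`: the `k`-th opener is before `t` iff more than `k` pushes precede `t`. [folklore] -/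
theorem openTime_lt_iff {k : ℕ} (hk : k < (openerSet (shedWord R H E y)).card) (t : ℕ) :
    openTime R H E y k < t ↔ k < pushes (shedPrefix R H E y t) := by
  unfold openTime
  rw [dif_pos hk]
  by_cases ht : t ≤ N
  · rcases ht.eq_or_lt with rfl | htN
    · rw [pushes_shedPrefix_N]
      exact ⟨fun _ => hk, fun _ => Fin.isLt _⟩
    · have e1 := orderEmbOfFin_lt_iff (rfl : (openerSet (shedWord R H E y)).card = _) ⟨k, hk⟩ ⟨t, htN⟩
      rw [filter_lt_fin_eq, Fin.lt_def] at e1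
      rw [e1, pushes_eq_card_openerSet R H E y (le_of_lt htN)]
  · rw [not_le] at ht
    constructor
    · intro
      exact lt_of_lt_of_le (by rw [pushes_shedPrefix_N R H E y]; exact hk) (pushes_mono R H E y (le_of_lt ht))
    · intro
      exact lt_trans (Fin.isLt _) ht

/-- Axiom `hc`: the `k`-th closer is before `t` iff more than `k` pops precede `t`. [folklore] -/
theorem closeTime_lt_iff (hbal : (closerSet (shedWord R H E y)).card = (openerSet (shedWord R H E y)).card) {k : ℕ}
    (hk : k < (openerSet (shedWord R H E y)).card) (t : ℕ) :
    closeTime R H E y hbal k < t ↔ k < pops (shedPrefix R H E y t) := by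
  unfold closeTime
  rw [dif_pos hk]
  by_cases ht : t < N
  · have e1 := orderEmbOfFin_lt_iff hbal ⟨k, hk⟩ ⟨t, ht⟩
    rw [filter_lt_fin_eq, Fin.lt_def] at e1
    rw [e1, pops_eq_card_closerSet R H E y (le_of_lt ht)]
  · rw [not_lt] at ht
    constructor
    · intro
      exact lt_of_lt_of_le (by rw [pops_shedPrefix_N R H E y, hbal]; exact hk) (pops_mono R H E y ht)
    · intro
      exact lt_of_lt_of_le (Fin.isLt _) ht

/-- Axiom `hresp`: a set of positions that is a union of arcs of the FIFO matching gives the `k`-th opener and the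
`k`-th closer the same colour. [folklore] -/
theorem colour_openTime_eq (hbal : (closerSet (shedWord R H E y)).card = (openerSet (shedWord R H E y)).card)
    (S : Finset (Fin N)) (hS : ∀ i, i ∈ S ↔ fifo (shedWord R H E y) hbal i ∈ S) {k : ℕ}
    (hk : k < (openerSet (shedWord R H E y)).card) :
    (openTime R H E y k ∈ S.map Fin.valEmbedding) ↔ (closeTime R H E y hbal k ∈ S.map Fin.valEmbedding) := by
  have h := (respects_fifo_iff S).1 hS ⟨k, hk⟩
  unfold openTime closeTime
  rw [dif_pos hk, dif_pos hk]
  simp only [mem_map, Fin.valEmbedding_apply]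
  constructor
  · rintro ⟨i, hi, he⟩
    rw [Fin.val_inj] at he; subst he
    exact ⟨_, h.1 hi, rfl⟩
  · rintro ⟨i, hi, he⟩
    rw [Fin.val_inj] at he; subst he
    exact ⟨_, h.2 hi, rfl⟩

/-! ### Bridge to the prefix recursion -/

/-- **The `k`-th opener is the position of the `k`-th push.** [folklore] -/
theorem openTime_eq_nthTrue {k : ℕ} (hk : k < (openerSet (shedWord R H E y)).card) :
    openTime R H E y k = nthTrue (shedPrefix R H E y N) k := by
  set p := nthTrue (shedPrefix R H E y N) k with hp
  have hkp : k < pushes (shedPrefix R H E y N) := by rwa [pushes_shedPrefix_N]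
  have hpN : p < N := by
    have := (nthTrue_lt_length_iff (shedPrefix R H E y N) k).2 hkp
    simpa using this
  have hletter : shedLetter R H E y p = true := by
    have h1 := getElem_nthTrue (shedPrefix R H E y N) k (by simpa using hpN)
    rwa [getElem_shedPrefix] at h1
  have hmem : (⟨p, hpN⟩ : Fin N) ∈ openerSet (shedWord R H E y) := mem_openerSet.2 hletter
  have hcount : ((openerSet (shedWord R H E y)).filter fun i => i < (⟨p, hpN⟩ : Fin N)).card = k := by
    rw [filter_lt_fin_eq, ← pushes_eq_card_openerSet R H E y (le_of_lt hpN), ← take_shedPrefix R H E y (le_of_lt hpN)]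
    exact pushes_take_nthTrue _ _ hkp
  have h := orderEmbOfFin_card_filter_lt (rfl : (openerSet (shedWord R H E y)).card = _) hmem
  unfold openTime
  rw [dif_pos hk]
  have hidx : (⟨k, hk⟩ : Fin (openerSet (shedWord R H E y)).card) =
      ⟨((openerSet (shedWord R H E y)).filter fun i => i < (⟨p, hpN⟩ : Fin N)).card,
        card_filter_lt_lt_card hmem⟩ := Fin.ext hcount.symm
  rw [hidx, h]

/-- **The front of the prefix recursion is item `rC t`**: with a non-empty queue at time `t ≤ N`, the push position
of the front item is the `pops`-th opener. [folklore] -/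
theorem frontPos_eq_openTime {t : ℕ} (ht : t ≤ N) (hne : pops (shedPrefix R H E y t) < pushes (shedPrefix R H E y t)) :
    frontPos (shedPrefix R H E y t) = openTime R H E y (pops (shedPrefix R H E y t)) := by
  have hk : pops (shedPrefix R H E y t) < (openerSet (shedWord R H E y)).card :=
    lt_of_lt_of_le hne (by rw [← pushes_shedPrefix_N]; exact pushes_mono R H E y ht)
  rw [openTime_eq_nthTrue R H E y hk, frontPos]
  have hsplit : shedPrefix R H E y N = shedPrefix R H E y t ++ (shedPrefix R H E y N).drop t := by
    conv_lhs => rw [← List.take_append_drop t (shedPrefix R H E y N)]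
    rw [take_shedPrefix R H E y ht]
  rw [hsplit, nthTrue_append_of_lt _ _ _ hne]

/-! ### The two structural facts of μ* -/

/-- **R-items have no S-successors.**  Before the tail, a PUSH at a non-defect position with a non-empty queue only
happens while the front item was NOT pushed at a defect (otherwise the position sheds). [folklore] -/
theorem isDefect_frontPos_eq_false_of_push {t : ℕ} (hd : isDefect R t = false) (hf : H ≤ t) (htE : t < E)
    (hne : pops (shedPrefix R H E y t) < pushes (shedPrefix R H E y t)) (hpush : shedLetter R H E y t = true) :
    isDefect R (frontPos (shedPrefix R H E y t)) = false := by
  by_contra hfront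
  rw [Bool.not_eq_false] at hfront
  rw [shedLetter_shed R H E y hd hf hne htE hfront] at hpush
  exact Bool.noConfusion hpush

/-- **Every other middle letter is the fair bit**: before the tail, past the fill, at a non-defect position with a
non-empty queue whose front was not pushed at a defect, the letter is `y t`. [folklore] -/
theorem shedLetter_eq_bit_of_front {t : ℕ} (hd : isDefect R t = false) (hf : H ≤ t) (htE : t < E)
    (hne : pops (shedPrefix R H E y t) < pushes (shedPrefix R H E y t))
    (hfront : isDefect R (frontPos (shedPrefix R H E y t)) = false) : shedLetter R H E y t = bit y t := by
  apply shedLetter_of_isFair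
  simp [isFair, hd, hf, htE, hne, hfront]

/-- The fair positions are exactly the middle non-defect positions with a non-empty queue and a non-defect front.
[folklore] -/
theorem isFair_iff (t : ℕ) : isFair R H E y t = true ↔
    isDefect R t = false ∧ H ≤ t ∧ pops (shedPrefix R H E y t) < pushes (shedPrefix R H E y t) ∧ t < E ∧
      isDefect R (frontPos (shedPrefix R H E y t)) = false := by
  simp only [isFair, Bool.and_eq_true, Bool.not_eq_true', decide_eq_true_eq]
  tauto

end Summit.ValiantsHypothesis.ValiantsHypothesis.Theorems.FifoMatching.NNLinearDegreeCofactorHard.ShedWord
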